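import Summits.QuantumFields.YangMills.Theorems.UnitScaleTiltFluctuationComparisonRegPrGlobalSlackKernelLegChi
import Summits.QuantumFields.YangMills.Theorems.UnitScaleTiltFluctuationComparisonRegPrGlobalSlackCanonicalPolymersCoreSizes
import HarnessLib

/-!
# `UnitScaleTiltFluctuationComparisonRegPrGlobalSlackKernelLegBirth` — THE CANONICAL BIRTH CHART FAMILY OF A FAMILY OF DATA CORES, AND THE BIRTH-LEVEL ROWS IT CARRIES
# (crux `FluctuationComparisonRegPrIntL`, stmt-QuantumFields-20520, skeleton v5kC, STUB 3⁗χ `stub_globalTwoRunSlackFamChi`; width seat ym-ust-20520-w1 g0, count-neutral helper)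

WHY.  Every socket of 3⁗χ (`K1aLegRowsRChi`, `K1aLegRowsRefChi`, `K1aLegRowsOwnChi`, the chart-currency `K1aChartRowsKChi`) asks for «ONE chart family `Φ : ChartFam`» carrying the
analytic rows, as an EXISTENTIAL.  For the NEWBORN terms the chart family is not a choice: by the displayed identities `hPY`/`hPYZ` the level-`(b+1)` term of run `K` on a retained
domain `X` of step `b` is `Re jet26(Ψ_X)(B_X) − far_X + Re jet26(Λ_X)(B_X) − far^Λ_X` (`newTermCore`), with the step chart `Ψ_X = (𝔖 b).Ψ X`, the G3D-07 chart `Λ_X = (𝔄.Λc b).Ψ X`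
and the loop variables `B_X = (𝔖 b).Bcfg X triv`.  This file DEFINES the canonical birth chart family of a family of data cores and proves its birth-level rows from the
displayed rows of the CORE step record (per run — each statement reads `q K` only):

* §1 `birthDoms q K b Y` (the retained step-`b` domains with point set `Y`: a singleton `{X}` at `Y = domSet X`, by `domSet_injective`), **`birthChartCore q : ChartFam`**
  (`Φ K b Y := Ψ_X + Λ_X` summed over `birthDoms`, below the top `b + 1 ≤ K`; `0` above), `birthCfgAt`, `birthFarAt`;
* §2 smoothness at the flat point from G3D-01 (`contDiffAt_stepChart`, `contDiffAt_lambdaChart`: holomorphic on `ball 0 ρ` ⟹ `Cⁿ` at `0`, [Chae1985] via `HolomorphicBanach`),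
  **`ker_birthChartCore_domSet`** (`ker Φ_{K,b,domSet X} d = DᵈΨ_X(0) + DᵈΛ_X(0)`), `jet26_birthChartCore_domSet` (the jet is additive);
* §3 **`canonPTCore_birth_eq`**: `canonPTCore q K (b+1) (b+1) (domSet X) W = Re jet26(Φ_{K,b,domSet X})(B_X(W)) − (far_X(W) + far^Λ_X(W))` — `TaylorSplitΦ` AT THE BIRTH LEVEL with
  vacuum constant `0` and rest `−(far + far^Λ)`, a THEOREM (not a row) for the canonical objects;
* §4 **`norm_ker_birthChartCore_le`**: `‖ker Φ_{K,b,domSet X} d‖ ≤ (C25 + C63)·max(1, 12/ρ)⁶·e^{−κ·dj X}` for `2 ≤ d ≤ 6` (Cauchy estimates, lane A's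
  `norm_iteratedFDeriv_zero_le_uniform`; `g_b ≤ 1` given away) and the `KernelSizeΦ`-shaped bound ON THE NEW LEVEL of the canonical polymerisation
  (`norm_ker_birthChartCore_le_of_mem_loc`, tree length `= dj X` by `canonTreeLenCore_domSet`).
WHAT THIS LOCATES (honestly, for NODE O's v4 record).  (a) OLD-LEVEL CARRIERS: the canonical polymerisation lists old terms by BLOCK (`blockSet y`), and `birthChartCore` vanishes on a
block that is not itself a retained domain's point set — the chart an old term needs is the `y`-ANCHORED re-localisation of the birth charts of the domains through `y` (print (33)–(34)
p.264, (43) p.266); that re-localisation + «old values are its jets at the current loop variables» is (M1), not displayed.  (b) THE SEVENTH-ORDER REST AT THE BIRTH LEVEL is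
`−(far_X + far^Λ_X)`; the displayed G3D-06 row bounds `|far_X| ≤ Cfar·(C25·g_b·e^{−κ𝓛})·g_b⁷(r(g_b)p(g_b))⁷` — the spare `g_b` absorbs `r(g_b)⁷` (`g·r(g)⁷ ≤ c(r₀)`) — but the G3D-07
row bounds `|far^Λ_X| ≤ Cfar·(C63·e^{−κ𝓛})·g_b⁷(r(g_b)p(g_b))⁷` with a `g`-FREE amplitude, and `r(g_b)^{7} = (1 + log g_b⁻¹)^{7r₀}` (`one_le_r₀`) is unbounded along the heights: the
row of record `RemainderSmallΦ … 𝔠.b₀ 𝔠.p₀ … C_R` (profile = the record's, `C_R` height-uniform, `σ = 7 : ℕ` downstream) does NOT follow from the displayed sup-norm far rows for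
the (61)-born pieces.  In print's leg currency ((43)–(44): per-leg kernel decay, distance-form loop variables, no collar polylogarithm) the order-7 rest is `O(θ⁷)·e^{−κ𝓛}` — so the
v4 display wanted is LEG-WEIGHTED ANALYTICITY of `Ψ_X + Λ_X` (= `ChartAnalyticΦ` of the leg-rescaled family, lane A's predicate) with `far = −(Taylor rest)`, not a sup-norm far row.
HONEST FRAMING: definitions + bookkeeping + Cauchy estimates over the core's displayed rows; nothing of [Balaban1985UV3] / [King1986] is asserted; registry untouched; YM₃ on T³ is a
rung, not the Clay problem / 𝕋⁴ / a mass gap.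

References: T. Bałaban, CMP 102 (1985) 255–275 [Balaban1985UV3] ((25) p.262, (27)–(30) p.263, (32)–(34) p.264, (43)–(45) pp.266–267, (57) p.270, (59)–(63) pp.270–272); S. B. Chae,
Holomorphy and Calculus in Normed Spaces (1985) [Chae1985] (13.6, 14.13); C. King, CMP 102 (1986) 649–677 [King1986] (Prop. 3.6 (3.55)–(3.56) p.662).
-/

set_option autoImplicit false

noncomputable section

open scoped BigOperators Nat
open Finset Metric
open Literature.MathematicalPhysics.QuantumFieldTheory.Balaban1983to89
open Literature.MathematicalPhysics.QuantumFieldTheory.Balaban1983to89.T3ContinuumYM3Torus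
open Literature.MathematicalPhysics.QuantumFieldTheory.Balaban1983to89.T3UnitScaleTilt
open Literature.MathematicalPhysics.QuantumFieldTheory.Balaban1983to89.T3LevelShift
open Literature.MathematicalPhysics.QuantumFieldTheory.Balaban1983to89.T3AlphaInputsAC
open Literature.MathematicalPhysics.QuantumFieldTheory.Balaban1983to89.T3AlphaPolymerSocket
open Literature.MathematicalPhysics.QuantumFieldTheory.Balaban1983to89.T3AlphaInputsACTwoRun
open Literature.MathematicalPhysics.QuantumFieldTheory.Balaban1983to89.T3AlphaInputsACTwoRunLevel
open Literature.MathematicalPhysics.QuantumFieldTheory.Balaban1983to89.TreeLengthTorus (tsys)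
open Literature.MathematicalPhysics.QuantumFieldTheory.Balaban1985CMP102
open Literature.MathematicalPhysics.QuantumFieldTheory.Balaban1985CMP102.Setting
open Literature.MathematicalPhysics.QuantumFieldTheory.Balaban1985CMP102.Binders (ChartAnalyticityAsCited)
open Summit.QuantumFields.Balaban3D.Carriers
open Summit.QuantumFields.Balaban3D.Proofs.Primitives
open Summit.QuantumFields.Balaban3D.Proofs.GroupModelLieC (lieC)
open Summit.QuantumFields.Balaban3D.Proofs.Representation33 (jet26)
open Summit.QuantumFields.Balaban3D.Proofs.ScalesArithmetic (gk_pos gk_le_one)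
open Summit.QuantumFields.YangMills.Theorems
open Summit.QuantumFields.YangMills.Theorems.GlobalSlackKernelMatching
open Summit.QuantumFields.YangMills.Theorems.GlobalSlackCanonicalPolymers

namespace Summit.QuantumFields.YangMills.Theorems.GlobalSlackKernelLeg

variable {F : T3Family} {𝔠 : AlphaConsts F.L (suGroupModel 2).N} {γ : ℝ} {hγ : 0 < γ} {hγ1 : γ ≤ (min 𝔠.gamma0 1) ^ 2}

/-! ## §1 The canonical birth chart family -/

section Defs

variable (q : ∀ K, AlphaInputsT3AC.PkgCoreV3 F 𝔠 γ hγ hγ1 K)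

open Classical in
/-- The retained step-`b` domains of run `K` (trivial history) whose point set is `Y` — empty or a singleton. [cite: Balaban1985UV3, (59) p.270] -/
def birthDoms (K b : ℕ) (Y : Set (Site (F.P K) 0)) : Finset (tsys 3 (nblkOf (SK F 𝔠 γ hγ hγ1 K) 𝔠.lane.carrier b)).Dom :=
  (newDomsCore q K b (Hist.triv (F.P K) (b + 1))).filter fun X => domSet (F := F) 𝔠.lane.carrier.M₁ K b X = Y

open Classical in
/-- **THE CANONICAL BIRTH CHART FAMILY OF A FAMILY OF DATA CORES**: run `K`, chart index `b` below the top (`b + 1 ≤ K`), point set `Y` ↦ the sum over the retained step-`b` domains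
`X` with `domSet X = Y` (at most one) of the step chart and the G3D-07 chart, `Ψ_X + Λ_X`, as a function on the step-`b` chart space; `0` above the top. [cite: Balaban1985UV3, (29)-(30) p.263, (33) p.264, (61)-(63) pp.271-272] -/
def birthChartCore : ChartFam ↥(lieC (suGroupModel 2)) F := fun K b Y =>
  if b + 1 ≤ K then fun x => ∑ X ∈ birthDoms q K b Y, ((((q K).𝔖 b).Ψ X) x + (((q K).𝔄.Λc b).Ψ X) x) else 0

open Classical in
/-- The birth configuration of the point set `Y` at the birth level `b + 1`: the loop variables `B_X(triv, W)` of the retained domain with point set `Y` (sum over `birthDoms`;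
`0` if there is none). [cite: Balaban1985UV3, (27) p.263, (43) p.266] -/
def birthCfgAt (K b : ℕ) (Y : Set (Site (F.P K) 0)) (W : GaugeField (F.P K) (b + 1) (Matrix.specialUnitaryGroup (Fin 2) ℂ)) :
    PBond (F.P K) b → ↥(lieC (suGroupModel 2)) :=
  ∑ X ∈ birthDoms q K b Y, ((q K).𝔖 b).Bcfg X (Hist.triv (F.P K) (b + 1)) W

open Classical in
/-- The birth-level far part of the point set `Y`: `far_X(triv, W) + far^Λ_X(triv, W)` of the retained domain with point set `Y` (sum over `birthDoms`).
[cite: Balaban1985UV3, (57) p.270, p.264 L15-16] -/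
def birthFarAt (K b : ℕ) (Y : Set (Site (F.P K) 0)) (W : GaugeField (F.P K) (b + 1) (Matrix.specialUnitaryGroup (Fin 2) ℂ)) : ℝ :=
  ∑ X ∈ birthDoms q K b Y, (((q K).𝔖 b).far X (Hist.triv (F.P K) (b + 1)) W + ((q K).𝔄.Λc b).far X (Hist.triv (F.P K) (b + 1)) W)

/-- At a retained domain's point set, `birthDoms = {X}` (`b ≤ m + K`). [cite: Balaban1985UV3, (59) p.270] -/
theorem birthDoms_domSet (K b : ℕ) (hbm : b ≤ F.m + K) (X : (tsys 3 (nblkOf (SK F 𝔠 γ hγ hγ1 K) 𝔠.lane.carrier b)).Dom)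
    (hX : X ∈ newDomsCore q K b (Hist.triv (F.P K) (b + 1))) : birthDoms q K b (domSet (F := F) 𝔠.lane.carrier.M₁ K b X) = {X} := by
  classical
  ext X'
  simp only [birthDoms, mem_filter, mem_singleton]
  exact ⟨fun h => domSet_injective K b hbm h.2, fun h => by subst h; exact ⟨hX, rfl⟩⟩

/-- Below the top, at a retained domain's point set, the birth chart IS `Ψ_X + Λ_X`. [cite: Balaban1985UV3, (33) p.264, (61) p.271] -/
theorem birthChartCore_domSet (K b : ℕ) (hb : b + 1 ≤ K) (X : (tsys 3 (nblkOf (SK F 𝔠 γ hγ hγ1 K) 𝔠.lane.carrier b)).Dom)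
    (hX : X ∈ newDomsCore q K b (Hist.triv (F.P K) (b + 1))) :
    birthChartCore q K b (domSet (F := F) 𝔠.lane.carrier.M₁ K b X) = ((q K).𝔖 b).Ψ X + ((q K).𝔄.Λc b).Ψ X := by
  have hbm : b ≤ F.m + K := by have := F.hm; omega
  funext x
  simp only [birthChartCore, if_pos hb, birthDoms_domSet q K b hbm X hX, sum_singleton, Pi.add_apply]

/-- Below the top, at a retained domain's point set, the birth configuration IS `B_X(triv, W)`. [cite: Balaban1985UV3, (27) p.263] -/
theorem birthCfgAt_domSet (K b : ℕ) (hbm : b ≤ F.m + K) (X : (tsys 3 (nblkOf (SK F 𝔠 γ hγ hγ1 K) 𝔠.lane.carrier b)).Dom)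
    (hX : X ∈ newDomsCore q K b (Hist.triv (F.P K) (b + 1))) (W : GaugeField (F.P K) (b + 1) (Matrix.specialUnitaryGroup (Fin 2) ℂ)) :
    birthCfgAt q K b (domSet (F := F) 𝔠.lane.carrier.M₁ K b X) W = ((q K).𝔖 b).Bcfg X (Hist.triv (F.P K) (b + 1)) W := by
  simp only [birthCfgAt, birthDoms_domSet q K b hbm X hX, sum_singleton]

/-- Below the top, at a retained domain's point set, the birth far part IS `far_X + far^Λ_X`. [cite: Balaban1985UV3, (57) p.270] -/
theorem birthFarAt_domSet (K b : ℕ) (hbm : b ≤ F.m + K) (X : (tsys 3 (nblkOf (SK F 𝔠 γ hγ hγ1 K) 𝔠.lane.carrier b)).Dom)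
    (hX : X ∈ newDomsCore q K b (Hist.triv (F.P K) (b + 1))) (W : GaugeField (F.P K) (b + 1) (Matrix.specialUnitaryGroup (Fin 2) ℂ)) :
    birthFarAt q K b (domSet (F := F) 𝔠.lane.carrier.M₁ K b X) W =
      ((q K).𝔖 b).far X (Hist.triv (F.P K) (b + 1)) W + ((q K).𝔄.Λc b).far X (Hist.triv (F.P K) (b + 1)) W := by
  simp only [birthFarAt, birthDoms_domSet q K b hbm X hX, sum_singleton]

end Defs

/-! ## §2 Smoothness at the flat point and the kernels of the birth charts -/

section Kernels

variable (q : ∀ K, AlphaInputsT3AC.PkgCoreV3 F 𝔠 γ hγ hγ1 K)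

/-- **THE JET IS ADDITIVE** for charts that are `Cⁿ` at the flat point (orders `2…6`). [folklore] -/
theorem jet26_add_of_contDiffAt {E : Type*} [NormedAddCommGroup E] [NormedSpace ℂ E] {f g : E → ℂ}
    (hf : ∀ n : ℕ, ContDiffAt ℂ n f 0) (hg : ∀ n : ℕ, ContDiffAt ℂ n g 0) (B : E) : jet26 (f + g) B = jet26 f B + jet26 g B := by
  unfold jet26
  rw [← sum_add_distrib]
  refine sum_congr rfl fun d _ => ?_
  rw [iteratedFDeriv_add_apply (hf d) (hg d)]
  show ((d ! : ℂ))⁻¹ • ((iteratedFDeriv ℂ d f 0 + iteratedFDeriv ℂ d g 0) fun _ => B) =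
    ((d ! : ℂ))⁻¹ • (iteratedFDeriv ℂ d f 0 fun _ => B) + ((d ! : ℂ))⁻¹ • (iteratedFDeriv ℂ d g 0 fun _ => B)
  rw [← smul_add]
  rfl

/-- **G3D-01 ⟹ `Cⁿ` AT THE FLAT POINT** for the step charts below the top: holomorphic on `ball 0 ρ` ⟹ `ContDiffAt ℂ n` at `0` ([Chae1985] 14.13 via `HolomorphicBanach`).
[cite: Balaban1985UV3, (29)-(30) p.263; Chae1985, Thm 14.13] -/
theorem contDiffAt_stepChart (K b : ℕ) (hb : b + 1 ≤ K) (X : (tsys 3 (nblkOf (SK F 𝔠 γ hγ hγ1 K) 𝔠.lane.carrier b)).Dom) (n : ℕ) :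
    ContDiffAt ℂ n (((q K).𝔖 b).Ψ X) 0 := by
  obtain ⟨hρ, hdiff, -⟩ := ((q K).runCore.steps b hb).chart X
  exact (Literature.Analysis.Complex.HolomorphicBanach.contDiffOn_of_differentiableOn hdiff isOpen_ball).contDiffAt
    (isOpen_ball.mem_nhds (mem_ball_self hρ))

/-- **G3D-07's chart row ⟹ `Cⁿ` AT THE FLAT POINT** for the (61)-born charts (every step: the row is a field of the data `𝔄.Λc`). [cite: Balaban1985UV3, (61)-(63) pp.271-272; Chae1985, Thm 14.13] -/
theorem contDiffAt_lambdaChart (K b : ℕ) (X : (tsys 3 (nblkOf (SK F 𝔠 γ hγ hγ1 K) 𝔠.lane.carrier b)).Dom) (n : ℕ) :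
    ContDiffAt ℂ n (((q K).𝔄.Λc b).Ψ X) 0 := by
  obtain ⟨hρ, hdiff, -⟩ := ((q K).𝔄.Λc b).chart X
  exact (Literature.Analysis.Complex.HolomorphicBanach.contDiffOn_of_differentiableOn hdiff isOpen_ball).contDiffAt
    (isOpen_ball.mem_nhds (mem_ball_self hρ))

/-- **THE FLAT KERNELS OF THE BIRTH CHART ARE THE SUMS OF THE TWO DISPLAYED CHARTS' KERNELS**: `ker Φ_{K,b,domSet X} d = DᵈΨ_X(0) + DᵈΛ_X(0)` (`b + 1 ≤ K`, `X` retained).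
[cite: King1986, (3.55) p.662; Balaban1985UV3, (33) p.264, (61) p.271] -/
theorem ker_birthChartCore_domSet (K b : ℕ) (hb : b + 1 ≤ K) (X : (tsys 3 (nblkOf (SK F 𝔠 γ hγ hγ1 K) 𝔠.lane.carrier b)).Dom)
    (hX : X ∈ newDomsCore q K b (Hist.triv (F.P K) (b + 1))) (d : ℕ) :
    ker (birthChartCore q) K b (domSet (F := F) 𝔠.lane.carrier.M₁ K b X) d =
      iteratedFDeriv ℂ d (((q K).𝔖 b).Ψ X) 0 + iteratedFDeriv ℂ d (((q K).𝔄.Λc b).Ψ X) 0 := by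
  unfold ker
  rw [birthChartCore_domSet q K b hb X hX]
  exact iteratedFDeriv_add_apply (contDiffAt_stepChart q K b hb X d) (contDiffAt_lambdaChart q K b X d)

/-- **THE JET OF THE BIRTH CHART IS THE SUM OF THE TWO JETS**: `jet26 Φ_{K,b,domSet X} B = jet26 Ψ_X B + jet26 Λ_X B`. [cite: Balaban1985UV3, (30) p.263, (33) p.264, (61) p.271] -/
theorem jet26_birthChartCore_domSet (K b : ℕ) (hb : b + 1 ≤ K) (X : (tsys 3 (nblkOf (SK F 𝔠 γ hγ hγ1 K) 𝔠.lane.carrier b)).Dom)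
    (hX : X ∈ newDomsCore q K b (Hist.triv (F.P K) (b + 1))) (B : PBond (F.P K) b → ↥(lieC (suGroupModel 2))) :
    jet26 (birthChartCore q K b (domSet (F := F) 𝔠.lane.carrier.M₁ K b X)) B = jet26 (((q K).𝔖 b).Ψ X) B + jet26 (((q K).𝔄.Λc b).Ψ X) B := by
  rw [birthChartCore_domSet q K b hb X hX]
  exact jet26_add_of_contDiffAt (fun n => contDiffAt_stepChart q K b hb X n) (fun n => contDiffAt_lambdaChart q K b X n) B

end Kernels

/-! ## §3 `TaylorSplitΦ` at the birth level is a theorem for the canonical objects -/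

section Birth

variable (q : ∀ K, AlphaInputsT3AC.PkgCoreV3 F 𝔠 γ hγ hγ1 K)

/-- **THE CANONICAL NEWBORN TERM IS THE JET OF THE BIRTH CHART AT THE BIRTH CONFIGURATION, MINUS THE FAR PARTS**: for `b + 1 ≤ K` and a retained step-`b` domain `X`,
`canonPTCore q K (b+1) (b+1) (domSet X) W = Re jet26(Φ_{K,b,domSet X})(B_X(triv,W)) − (far_X(triv,W) + far^Λ_X(triv,W))` — the structure row `TaylorSplitΦ` AT THE BIRTH LEVEL, with
vacuum constant `0` (the `Ψ(0)` sit in `E^{(b)}`) and rest `−(far + far^Λ)`, from the displayed identity behind `newTermCore` (`hPY`/`hPYZ`). [cite: Balaban1985UV3, (33) p.264, (43) p.266, (57) p.270, (60)-(61) p.271] -/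
theorem canonPTCore_birth_eq (K b : ℕ) (hb : b + 1 ≤ K) (X : (tsys 3 (nblkOf (SK F 𝔠 γ hγ hγ1 K) 𝔠.lane.carrier b)).Dom)
    (hX : X ∈ newDomsCore q K b (Hist.triv (F.P K) (b + 1))) (W : GaugeField (F.P K) (b + 1) (Matrix.specialUnitaryGroup (Fin 2) ℂ)) :
    canonPTCore q K (b + 1) (b + 1) (domSet (F := F) 𝔠.lane.carrier.M₁ K b X) W =
      (jet26 (birthChartCore q K b (domSet (F := F) 𝔠.lane.carrier.M₁ K b X)) (((q K).𝔖 b).Bcfg X (Hist.triv (F.P K) (b + 1)) W)).re -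
        (((q K).𝔖 b).far X (Hist.triv (F.P K) (b + 1)) W + ((q K).𝔄.Λc b).far X (Hist.triv (F.P K) (b + 1)) W) := by
  rw [canonPTCore_new_eq q K b hb X hX W, jet26_birthChartCore_domSet q K b hb X hX, Complex.add_re]
  unfold newTermCore
  ring

/-- The same with the canonical birth configuration / far part of the POINT SET (`birthCfgAt`, `birthFarAt`): for `b + 1 ≤ K` and a retained domain's point set,
`canonPTCore q K (b+1) (b+1) Y W = Re jet26(Φ_{K,b,Y})(birthCfgAt q K b Y W) − birthFarAt q K b Y W`. [cite: Balaban1985UV3, (33) p.264, (43) p.266, (57) p.270] -/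
theorem canonPTCore_birth_eq' (K b : ℕ) (hb : b + 1 ≤ K) (X : (tsys 3 (nblkOf (SK F 𝔠 γ hγ hγ1 K) 𝔠.lane.carrier b)).Dom)
    (hX : X ∈ newDomsCore q K b (Hist.triv (F.P K) (b + 1))) (W : GaugeField (F.P K) (b + 1) (Matrix.specialUnitaryGroup (Fin 2) ℂ)) :
    canonPTCore q K (b + 1) (b + 1) (domSet (F := F) 𝔠.lane.carrier.M₁ K b X) W =
      (jet26 (birthChartCore q K b (domSet (F := F) 𝔠.lane.carrier.M₁ K b X)) (birthCfgAt q K b (domSet (F := F) 𝔠.lane.carrier.M₁ K b X) W)).re -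
        birthFarAt q K b (domSet (F := F) 𝔠.lane.carrier.M₁ K b X) W := by
  have hbm : b ≤ F.m + K := by have := F.hm; omega
  rw [birthCfgAt_domSet q K b hbm X hX, birthFarAt_domSet q K b hbm X hX]
  exact canonPTCore_birth_eq q K b hb X hX W

end Birth

/-! ## §4 The kernel sizes of the birth charts (Cauchy estimates) -/

section Sizes

variable (q : ∀ K, AlphaInputsT3AC.PkgCoreV3 F 𝔠 γ hγ hγ1 K)

/-- The birth-kernel constant `(C25 + C63)·max(1, 12/ρ)⁶` (both displayed amplitudes through the order-`≤ 6` Cauchy inequality). [cite: Balaban1985UV3, (25) p.262, (34) p.264] -/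
def birthKerConst (𝔠 : AlphaConsts F.L (suGroupModel 2).N) : ℝ := (𝔠.C25 + 𝔠.C63) * (max 1 (12 / 𝔠.ρ)) ^ 6

/-- `0 ≤ birthKerConst 𝔠`. [folklore] -/
theorem birthKerConst_nonneg (𝔠 : AlphaConsts F.L (suGroupModel 2).N) : 0 ≤ birthKerConst 𝔠 := by
  unfold birthKerConst
  have := 𝔠.C25_nonneg; have := 𝔠.C63_nonneg
  positivity

/-- **THE FLAT KERNELS OF THE BIRTH CHARTS, ORDERS `2…6`, ARE `≤ (C25 + C63)·max(1,12/ρ)⁶·e^{−κ·dj X}` IN OPERATOR NORM** (`b + 1 ≤ K`, `X` retained): G3D-01 for `Ψ_X`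
(amplitude `C25·g_b·e^{−κ dj X}`, `g_b ≤ 1` given away) and G3D-07's chart row for `Λ_X` (amplitude `C63·e^{−κ dj X}`) through the Cauchy inequality. [cite: Balaban1985UV3, Prop. 3 (34) p.264, (25) p.262; Chae1985, 13.6] -/
theorem norm_ker_birthChartCore_le (K b : ℕ) (hb : b + 1 ≤ K) (X : (tsys 3 (nblkOf (SK F 𝔠 γ hγ hγ1 K) 𝔠.lane.carrier b)).Dom)
    (hX : X ∈ newDomsCore q K b (Hist.triv (F.P K) (b + 1))) {d : ℕ} (hd : d ∈ Finset.Ico 2 7) :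
    ‖ker (birthChartCore q) K b (domSet (F := F) 𝔠.lane.carrier.M₁ K b X) d‖ ≤
      birthKerConst 𝔠 * Real.exp (-(𝔠.κ * (tsys 3 (nblkOf (SK F 𝔠 γ hγ hγ1 K) 𝔠.lane.carrier b)).dj X)) := by
  have hd6 : d ≤ 6 := by have := (Finset.mem_Ico.mp hd).2; omega
  set e : ℝ := Real.exp (-(𝔠.κ * (tsys 3 (nblkOf (SK F 𝔠 γ hγ hγ1 K) 𝔠.lane.carrier b)).dj X)) with he
  have he0 : 0 ≤ e := (Real.exp_pos _).le
  have hg0 : 0 < (SK F 𝔠 γ hγ hγ1 K).gk b := gk_pos _ b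
  have hg1 : (SK F 𝔠 γ hγ hγ1 K).gk b ≤ 1 := gk_le_one _ (SK F 𝔠 γ hγ hγ1 K).gK_le_one b (by show b ≤ K; omega)
  have hcΨ : ChartAnalyticityAsCited (E := PBond (F.P K) b → ↥(lieC (suGroupModel 2))) (((q K).𝔖 b).Ψ X) 𝔠.ρ
      (𝔠.C25 * (SK F 𝔠 γ hγ hγ1 K).gk b * e) := ((q K).runCore.steps b hb).chart X
  have hcΛ : ChartAnalyticityAsCited (E := PBond (F.P K) b → ↥(lieC (suGroupModel 2))) (((q K).𝔄.Λc b).Ψ X) 𝔠.ρ (𝔠.C63 * e) :=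
    ((q K).𝔄.Λc b).chart X
  have hΨ := norm_iteratedFDeriv_zero_le_uniform hcΨ hd6
  have hΛ := norm_iteratedFDeriv_zero_le_uniform hcΛ hd6
  have hM : 0 ≤ (max 1 (12 / 𝔠.ρ)) ^ 6 := by positivity
  rw [ker_birthChartCore_domSet q K b hb X hX d]
  refine (norm_add_le_of_le (a₁ := iteratedFDeriv ℂ d (((q K).𝔖 b).Ψ X) 0) (a₂ := iteratedFDeriv ℂ d (((q K).𝔄.Λc b).Ψ X) 0)
    hΨ hΛ).trans ?_
  have h1 : 𝔠.C25 * (SK F 𝔠 γ hγ hγ1 K).gk b * e ≤ 𝔠.C25 * e := by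
    have := 𝔠.C25_nonneg
    calc 𝔠.C25 * (SK F 𝔠 γ hγ hγ1 K).gk b * e ≤ 𝔠.C25 * 1 * e := by gcongr
      _ = 𝔠.C25 * e := by ring
  calc 𝔠.C25 * (SK F 𝔠 γ hγ hγ1 K).gk b * e * (max 1 (12 / 𝔠.ρ)) ^ 6 + 𝔠.C63 * e * (max 1 (12 / 𝔠.ρ)) ^ 6
      ≤ 𝔠.C25 * e * (max 1 (12 / 𝔠.ρ)) ^ 6 + 𝔠.C63 * e * (max 1 (12 / 𝔠.ρ)) ^ 6 := by gcongr
    _ = birthKerConst 𝔠 * e := by unfold birthKerConst; ring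

/-- **`KernelSizeΦ`-SHAPED BOUND ON THE NEW LEVEL OF THE CANONICAL POLYMERISATION**: for `b + 1 ≤ K` and every listed domain `Y` of term level `b+1` at lattice level `b+1` of run `K`
(the retained domains' point sets), `‖ker Φ_{K,b,Y} d‖ ≤ birthKerConst·e^{−κ·𝓛_K(b+1, Y)}` for `2 ≤ d ≤ 6` — the canonical tree length of `domSet X` being `dj X`.
[cite: Balaban1985UV3, Prop. 3 (34) p.264, (24)-(25) p.262, (43) p.266] -/
theorem norm_ker_birthChartCore_le_of_mem_loc (K b : ℕ) (hb : b + 1 ≤ K) (Y : Set (Site (F.P K) 0))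
    (hY : Y ∈ (AlphaInputsT3AC.dataOfCoreV3 q (canonPolymerCore q)).Loc K (b + 1)
      ((AlphaInputsT3AC.dataOfCoreV3 q (canonPolymerCore q)).triv K (b + 1)) (b + 1))
    {d : ℕ} (hd : d ∈ Finset.Ico 2 7) :
    ‖ker (birthChartCore q) K b Y d‖ ≤
      birthKerConst 𝔠 * Real.exp (-(𝔠.κ * (AlphaInputsT3AC.dataOfCoreV3 q (canonPolymerCore q)).treeLen K (b + 1) Y)) := by
  classical
  have hbm : b ≤ F.m + K := by have := F.hm; omega
  change Y ∈ canonLocCore q K (b + 1) (Hist.triv (F.P K) (b + 1)) (b + 1) at hY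
  simp only [canonLocCore, if_pos hb, ite_true, mem_image] at hY
  obtain ⟨X, hX, rfl⟩ := hY
  change ‖ker (birthChartCore q) K b (domSet (F := F) 𝔠.lane.carrier.M₁ K b X) d‖ ≤
    birthKerConst 𝔠 * Real.exp (-(𝔠.κ * canonTreeLenCore q K (b + 1) (domSet (F := F) 𝔠.lane.carrier.M₁ K b X)))
  rw [canonTreeLenCore_domSet q K b hbm X]
  exact norm_ker_birthChartCore_le q K b hb X hX hd

end Sizes

end Summit.QuantumFields.YangMills.Theorems.GlobalSlackKernelLeg

end
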